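import Summits.CriticalPhenomena.Ising3DConformalLimit.Theorems.FKParityRobustnessDefs
import HarnessLib

/-!
# Route `FKParityRobustness`, crux `IndependentStrandsJoin` (stmt-CriticalPhenomena-14625):
# vocabulary of the line `cross-fattening-decoupling`

Route-posited objects (D-0016 `<Route>Defs`-type file) shared by the registered stubs of the skeleton
`Cruxes/IndependentStrandsJoin/Lines/cross_fattening_decoupling.lean` and by the crux file that composes
them.  Everything here is a plain finite-graph / finite-sum definition over the tree's `tJoins` and
`loopO1PartitionFunction` (`Literature/Probability/LatticeModels/LoopO1.lean`); nothing is asserted.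
The namespace is the skeleton's (`…Cruxes.IndependentStrandsJoin.CrossFatteningDecoupling`), so the
registered stub signatures read verbatim over this file.

The line (idea card `Cruxes/IndependentStrandsJoin/Ideas/cross-fattening-decoupling.md`): for a `T`-join
`F` of `{x, y}` write `K_x(F) = cl F x` (the edges of the `F`-component of `x`, the SOURCE CLUSTER — the
tree convention of `Theorems/FKParityRobustnessDepletionBoundClusters.lean`, there written as an inline
`Finset.filter`) and `L_x(F) = soup F x = F ∖ K_x(F)` (its SOUP, an even subgraph off the vertices of
`K_x(F)`).  For `F₁ ∈ 𝒯(a₀a₁)`, `F₂ ∈ 𝒯(a₂a₃)` the soups are CROSSED: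
`X₁ = {u : a₀ ↝_{K₁ ∪ L₂} u}`, `X₂ = {u : a₂ ↝_{K₂ ∪ L₁} u}`, `N_B = #(X₁ ∩ X₂ ∩ B)`.

* `rch F x v` — reachability inside the edge set `F`; `cl`, `soup`, `offCl` (the depleted edge domain
  `E(G − V(K))`), `srcClusters` (self-clustered `T`-joins), `crossCount` (`N_B`);
* `attachOff`, `attachFull` — depleted / un-depleted soup attachment masses of a fixed edge set `K`;
  `zOff` (`Z^∅(G − V(K))`), `zPair` (`Z^{{x}∆{y}}`, so `⟨σ_xσ_y⟩^free = zPair/Z^∅` with `⟨σ_xσ_x⟩ = 1`);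
* `profile` (double-current window profile), `treePair`, `bubbleSum` (ADC tree numerators and the window
  bubble), `crossMoment`, `crossMomentSq`, `crossMomentK`, `fullMass`, `posMass`, `jointSum` (verbatim the
  crux's right-hand side), `window N l` (the central window `{u ∈ Λ_N : 2|uᵢ| ≤ l}`);
* small API: `cl_subset`, `soup_subset`, `reachable_of_crossCount_pos` (CROSS INCLUSION: a window point
  in both crossed clusters joins `x₁` to `x₂` inside `F₁ ∪ F₂`), `zPair_nonneg`, `profile_nonneg`,
  `posMass_nonneg`, `posMass_le_jointSum`; its closed form is the registered bookkeeping stub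
  `stub_crossInclusion` of the skeleton (namespace `…Theorems`, end of file), through which this
  vocabulary file lands as a `--supports` file.

References: M. Aizenman, H. Duminil-Copin, Ann. of Math. 194 (2021), arXiv:1912.07973, Lemma 4.4 and
Prop. A.3 (the second-moment template) [AizenmanDuminilCopinAnnals2021]; U. T. Hansen, J. Jiang,
F. R. Klausen, arXiv:2506.10765 §2 (sourced loop O(1)) [HansenJiangKlausen2025]; the line card
`Cruxes/IndependentStrandsJoin/Lines/cross-fattening-decoupling.md`.
-/

noncomputable section

open Finset SimpleGraph
open Literature.Probability.LatticeModels

namespace Summit.CriticalPhenomena.Ising3DConformalLimit.Cruxes.IndependentStrandsJoin.CrossFatteningDecoupling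

open scoped Classical BigOperators symmDiff

/-! ### Vocabulary (general finite graph) -/

section Vocabulary

variable {V : Type*}

/-- `x ↝_F v`: reachability inside the edge set `F`. -/
abbrev rch (F : Finset (Sym2 V)) (x v : V) : Prop :=
  (SimpleGraph.fromEdgeSet (↑F : Set (Sym2 V))).Reachable x v

/-- The SOURCE CLUSTER `K_x(F)`: the edges of `F` having an endpoint `F`-reachable from `x` (tree convention of
`Theorems/FKParityRobustnessDepletionBoundClusters.lean`). -/
def cl (F : Finset (Sym2 V)) (x : V) : Finset (Sym2 V) :=
  F.filter (fun e => ∃ v ∈ e, rch F x v)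

/-- The DEPLETED DOMAIN `E(G − V(K))`: edges none of whose endpoints is `K`-reachable from `x`. -/
def offCl (K : Finset (Sym2 V)) (x : V) : Set (Sym2 V) :=
  {e | ∀ v ∈ e, ¬ rch K x v}

variable [DecidableEq V]

/-- The SOUP `L_x(F) = F ∖ K_x(F)` of `F` off its `x`-cluster (an even subgraph avoiding the vertices of `K_x(F)`). -/
def soup (F : Finset (Sym2 V)) (x : V) : Finset (Sym2 V) :=
  F \ cl F x

/-- The CROSSED WINDOW COUNT `N_B(F₁,F₂) = #{u ∈ B : a₀ ↝_{K₁ ∪ L₂} u ∧ a₂ ↝_{K₂ ∪ L₁} u}`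
(`Kᵢ = cl Fᵢ xᵢ`, `Lᵢ = soup Fᵢ xᵢ`). -/
def crossCount (x₁ x₂ : V) (B : Finset V) (F₁ F₂ : Finset (Sym2 V)) : ℕ :=
  #(B.filter (fun u => rch (cl F₁ x₁ ∪ soup F₂ x₂) x₁ u ∧ rch (cl F₂ x₂ ∪ soup F₁ x₁) x₂ u))

omit [DecidableEq V] in
/-- `K_x(F) ⊆ F`. -/
theorem cl_subset (F : Finset (Sym2 V)) (x : V) : cl F x ⊆ F :=
  Finset.filter_subset _ _

/-- `L_x(F) ⊆ F`. -/
theorem soup_subset (F : Finset (Sym2 V)) (x : V) : soup F x ⊆ F :=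
  Finset.sdiff_subset

/-- **Cross inclusion.**  A window point in both crossed clusters joins `x₁` to `x₂` inside `F₁ ∪ F₂`
(`K₁ ∪ L₂ ⊆ F₁ ∪ F₂ ⊇ K₂ ∪ L₁`). -/
theorem reachable_of_crossCount_pos {x₁ x₂ : V} {B : Finset V} {F₁ F₂ : Finset (Sym2 V)}
    (h : 0 < crossCount x₁ x₂ B F₁ F₂) :
    (SimpleGraph.fromEdgeSet ((↑F₁ : Set (Sym2 V)) ∪ ↑F₂)).Reachable x₁ x₂ := by
  unfold crossCount at h
  obtain ⟨u, hu⟩ := Finset.card_pos.1 h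
  rw [Finset.mem_filter] at hu
  obtain ⟨-, h₁, h₂⟩ := hu
  have hsub₁ : (↑(cl F₁ x₁ ∪ soup F₂ x₂) : Set (Sym2 V)) ⊆ (↑F₁ : Set (Sym2 V)) ∪ ↑F₂ := by
    rw [Finset.coe_union]
    exact Set.union_subset_union (Finset.coe_subset.2 (cl_subset F₁ x₁))
      (Finset.coe_subset.2 (soup_subset F₂ x₂))
  have hsub₂ : (↑(cl F₂ x₂ ∪ soup F₁ x₁) : Set (Sym2 V)) ⊆ (↑F₁ : Set (Sym2 V)) ∪ ↑F₂ := by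
    rw [Finset.coe_union, Set.union_comm]
    exact Set.union_subset_union (Finset.coe_subset.2 (soup_subset F₁ x₁))
      (Finset.coe_subset.2 (cl_subset F₂ x₂))
  exact (h₁.mono (SimpleGraph.fromEdgeSet_mono hsub₁)).trans
    (h₂.mono (SimpleGraph.fromEdgeSet_mono hsub₂)).symm

variable [Fintype V] (G : SimpleGraph V) [DecidableRel G.Adj]

/-- SOURCE CLUSTERS with source set `S` rooted at `x`: the self-clustered `T`-joins (`K_x(K) = K`). -/
def srcClusters (x : V) (S : Finset V) : Finset (Finset (Sym2 V)) :=
  (tJoins G Set.univ S).filter (fun K => cl K x = K)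

/-- DEPLETED crossed attachment mass `A(x; K | K'; u) = Σ_{L ∈ 𝓔_∅(G − V(K'))} t^{|L|} 1[x ↝_{K ∪ L} u]`
(`K'` rooted at `x'`). -/
def attachOff (t : ℝ) (x : V) (K : Finset (Sym2 V)) (x' : V) (K' : Finset (Sym2 V)) (u : V) : ℝ :=
  ∑ L ∈ tJoins G (offCl K' x') ∅, if rch (K ∪ L) x u then t ^ #L else 0

/-- UN-DEPLETED attachment mass `A⁺(x; K; u) = Σ_{L ∈ 𝓔_∅(G)} t^{|L|} 1[x ↝_{K ∪ L} u]` (independent FULL soup). -/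
def attachFull (t : ℝ) (x : V) (K : Finset (Sym2 V)) (u : V) : ℝ :=
  ∑ L ∈ tJoins G Set.univ ∅, if rch (K ∪ L) x u then t ^ #L else 0

/-- Depleted vacuum partition function `Z^∅(G − V(K)) = Σ_{L ∈ 𝓔_∅(G − V(K))} t^{|L|}`. -/
def zOff (t : ℝ) (x : V) (K : Finset (Sym2 V)) : ℝ :=
  ∑ L ∈ tJoins G (offCl K x) ∅, t ^ #L

/-- Pair partition function with the coincidence convention, `Z^{{x} ∆ {y}}` (so `zPair x x = Z^∅`, matching
`⟨σ_xσ_x⟩ = 1`; `⟨σ_xσ_y⟩^free_G = zPair x y / Z^∅`). -/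
def zPair (t : ℝ) (x y : V) : ℝ :=
  loopO1PartitionFunction G t ({x} ∆ {y})

/-- The DOUBLE-CURRENT WINDOW PROFILE `Σ_{u ∈ B} Z(a₀u)Z(ua₁)·Z(a₂u)Z(ua₃)`
(`= (Z^∅)²·Z₀₁Z₂₃ · Σ_{u∈B} π₁(u)π₂(u)`). -/
def profile (t : ℝ) (a : Fin 4 → V) (B : Finset V) : ℝ :=
  ∑ u ∈ B, zPair G t (a 0) u * zPair G t u (a 1) * (zPair G t (a 2) u * zPair G t u (a 3))

/-- The ADC tree numerator `Z(xv)Z(vw)Z(wy) + Z(xw)Z(wv)Z(vy)` (ADC2021 Prop. A.3 times `(Z^∅)²·Z^{xy}`). -/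
def treePair (t : ℝ) (x y v w : V) : ℝ :=
  zPair G t x v * zPair G t v w * zPair G t w y + zPair G t x w * zPair G t w v * zPair G t v y

/-- The window BUBBLE `Σ_{v,w ∈ B} tree₁(v,w)·tree₂(v,w)`. -/
def bubbleSum (t : ℝ) (a : Fin 4 → V) (B : Finset V) : ℝ :=
  ∑ v ∈ B, ∑ w ∈ B, treePair G t (a 0) (a 1) v w * treePair G t (a 2) (a 3) v w

/-- First crossed moment (un-normalised `Z₀₁Z₂₃·E[N_B]`). -/
def crossMoment (t : ℝ) (x₁ y₁ x₂ y₂ : V) (B : Finset V) : ℝ :=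
  ∑ F₁ ∈ tJoins G Set.univ {x₁, y₁}, ∑ F₂ ∈ tJoins G Set.univ {x₂, y₂},
    t ^ (#F₁ + #F₂) * (crossCount x₁ x₂ B F₁ F₂ : ℝ)

/-- Second crossed moment (un-normalised `Z₀₁Z₂₃·E[N_B²]`). -/
def crossMomentSq (t : ℝ) (x₁ y₁ x₂ y₂ : V) (B : Finset V) : ℝ :=
  ∑ F₁ ∈ tJoins G Set.univ {x₁, y₁}, ∑ F₂ ∈ tJoins G Set.univ {x₂, y₂},
    t ^ (#F₁ + #F₂) * (crossCount x₁ x₂ B F₁ F₂ : ℝ) ^ 2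

/-- First crossed moment written through the source clusters (conditional independence given `(K₁, K₂)`). -/
def crossMomentK (t : ℝ) (x₁ y₁ x₂ y₂ : V) (B : Finset V) : ℝ :=
  ∑ K₁ ∈ srcClusters G x₁ {x₁, y₁}, ∑ K₂ ∈ srcClusters G x₂ {x₂, y₂},
    t ^ (#K₁ + #K₂) * ∑ u ∈ B, attachOff G t x₁ K₁ x₂ K₂ u * attachOff G t x₂ K₂ x₁ K₁ u

/-- Un-depleted one-point mass `Σ_{K} t^{|K|} Z^∅(G − V(K)) A⁺(x;K;u)` (`= Z^{xy}Z^∅ · P[u ∈ C(x; K ∪ L')]`). -/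
def fullMass (t : ℝ) (x y : V) (u : V) : ℝ :=
  ∑ K ∈ srcClusters G x {x, y}, t ^ #K * zOff G t x K * attachFull G t x K u

/-- Mass of the configuration pairs with a positive crossed count (`Z₀₁Z₂₃·P[N_B > 0]`). -/
def posMass (t : ℝ) (x₁ y₁ x₂ y₂ : V) (B : Finset V) : ℝ :=
  ∑ F₁ ∈ tJoins G Set.univ {x₁, y₁}, ∑ F₂ ∈ tJoins G Set.univ {x₂, y₂},
    if 0 < crossCount x₁ x₂ B F₁ F₂ then t ^ (#F₁ + #F₂) else 0

/-- The crux's joint sum `Σ_{F₁,F₂} t^{|F₁|+|F₂|} 1[a₀ ↔ a₂ in F₁ ∪ F₂]` (verbatim the crux's right-hand side). -/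
def jointSum (t : ℝ) (a : Fin 4 → V) : ℝ :=
  ∑ F₁ ∈ tJoins G Set.univ {a 0, a 1}, ∑ F₂ ∈ tJoins G Set.univ {a 2, a 3},
    if (SimpleGraph.fromEdgeSet ((↑F₁ : Set (Sym2 V)) ∪ ↑F₂)).Reachable (a 0) (a 2)
      then t ^ (#F₁ + #F₂) else 0

/-- `zPair ≥ 0` for `t ≥ 0`. -/
theorem zPair_nonneg {t : ℝ} (ht : 0 ≤ t) (x y : V) : 0 ≤ zPair G t x y :=
  loopO1PartitionFunction_nonneg G ht _

/-- `profile ≥ 0` for `t ≥ 0`. -/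
theorem profile_nonneg {t : ℝ} (ht : 0 ≤ t) (a : Fin 4 → V) (B : Finset V) : 0 ≤ profile G t a B := by
  unfold profile
  refine Finset.sum_nonneg fun u _ => ?_
  exact mul_nonneg (mul_nonneg (zPair_nonneg G ht _ _) (zPair_nonneg G ht _ _))
    (mul_nonneg (zPair_nonneg G ht _ _) (zPair_nonneg G ht _ _))

/-- `posMass ≥ 0` for `t ≥ 0`. -/
theorem posMass_nonneg {t : ℝ} (ht : 0 ≤ t) (x₁ y₁ x₂ y₂ : V) (B : Finset V) :
    0 ≤ posMass G t x₁ y₁ x₂ y₂ B := by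
  unfold posMass
  refine Finset.sum_nonneg fun F₁ _ => Finset.sum_nonneg fun F₂ _ => ?_
  split_ifs
  · positivity
  · exact le_rfl

/-- **`P[N_B > 0] ≤ P[crux event]`** with cleared denominators: `posMass ≤ jointSum` (the cross inclusion,
termwise, weights `t^{|F₁|+|F₂|} ≥ 0`). -/
theorem posMass_le_jointSum {t : ℝ} (ht : 0 ≤ t) (a : Fin 4 → V) (B : Finset V) :
    posMass G t (a 0) (a 1) (a 2) (a 3) B ≤ jointSum G t a := by
  unfold posMass jointSum
  refine Finset.sum_le_sum fun F₁ _ => Finset.sum_le_sum fun F₂ _ => ?_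
  by_cases h : 0 < crossCount (a 0) (a 2) B F₁ F₂
  · rw [if_pos h, if_pos (reachable_of_crossCount_pos h)]
  · rw [if_neg h]
    split_ifs
    · positivity
    · exact le_rfl

end Vocabulary

/-! ### The box setting -/

/-- The central WINDOW `B_l = {u ∈ Λ_N : 2|uᵢ| ≤ l}` of the box `Λ_N = box 3 N`. -/
def window (N l : ℕ) : Finset ↥(box 3 N) :=
  Finset.univ.filter (fun u : ↥(box 3 N) => ∀ i, 2 * |((u : Site 3) i)| ≤ (l : ℤ))

end Summit.CriticalPhenomena.Ising3DConformalLimit.Cruxes.IndependentStrandsJoin.CrossFatteningDecoupling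

/-! ### The registered bookkeeping stub `stub_crossInclusion` -/

namespace Summit.CriticalPhenomena.Ising3DConformalLimit.Theorems

open Summit.CriticalPhenomena.Ising3DConformalLimit.Cruxes.IndependentStrandsJoin.CrossFatteningDecoupling

/-- **Registered stub `stub_crossInclusion` of the line `cross-fattening-decoupling`** (crux
stmt-CriticalPhenomena-14625): on every finite graph, for `t ≥ 0`, every source map `a` and window `B`,
the mass of the configuration pairs with a positive crossed window count is at most the crux's joint sum,
`posMass ≤ jointSum` — a window point `u ∈ X₁ ∩ X₂` joins `a₀ ↝_{K₁∪L₂} u ↝_{K₂∪L₁} a₂` inside `F₁ ∪ F₂`. -/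
theorem stub_crossInclusion :
    ∀ (V : Type) [Fintype V] [DecidableEq V] (G : SimpleGraph V) [DecidableRel G.Adj] (t : ℝ),
      0 ≤ t → ∀ (a : Fin 4 → V) (B : Finset V),
      posMass G t (a 0) (a 1) (a 2) (a 3) B ≤ jointSum G t a :=
  fun _ _ _ G _ _ ht a B => posMass_le_jointSum G ht a B

end Summit.CriticalPhenomena.Ising3DConformalLimit.Theorems

end
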